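import Literature.MathematicalPhysics.KineticTheory.HardSphereMildBBGKY
import HarnessLib

/-!
# Towards the one-step mild BBGKY hierarchy almost everywhere: summing the windows
(Cercignani–Illner–Pulvirenti 1994 §4.3, Thm 4.3.1, App. 4.B; trunk T-KINETIC, topic
MathematicalPhysics/KineticTheory; continuation of `HardSphereMildBBGKY`.)

This file sums the window decomposition `window_increment_decomposition` over the windows
`(jδ, (j+1)δ]` of `(0, t]`:

* §Plumbing — the collision-coordinate integrals of the windows, written over the absolute
  collision time: translation of the time coordinate (`integral_comp_timeShift`) and additivity
  over consecutive windows (`sum_integral_timeWindows`); telescoping of the increments.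

## References

* C. Cercignani, R. Illner, M. Pulvirenti, *The Mathematical Theory of Dilute Gases*, Springer
  (1994), §4.3, App. 4.B.
-/

open MeasureTheory MeasureTheory.Measure Metric Real Set Filter Function
open scoped ENNReal InnerProductSpace
open Literature.Analysis.FluidPDE Literature.Analysis

namespace Literature.MathematicalPhysics.KineticTheory

noncomputable section

section Kinetic

variable {d : Type*} [Fintype d]

section Plumbing

/-- **The time shift of the collision coordinates is measure preserving** from time window
`(0, δ]` to `(a, a + δ]` (translation invariance of Lebesgue measure). [folklore] -/
theorem measurePreserving_timeShift {n : ℕ} (a δ : ℝ) :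
    MeasurePreserving (fun p : (Config n d (UnitAddTorus d) × EuclideanSpace ℝ d) × (sphere (0 : EuclideanSpace ℝ d) 1 × ℝ) => (p.1, (p.2.1, p.2.2 + a)))
      ((((volume : Measure (Config n d (UnitAddTorus d))).prod (volume : Measure (EuclideanSpace ℝ d))).prod ((((volume : Measure (EuclideanSpace ℝ d)).toSphere).prod ((volume : Measure ℝ).restrict (Ioc 0 δ)))))) ((((volume : Measure (Config n d (UnitAddTorus d))).prod (volume : Measure (EuclideanSpace ℝ d))).prod ((((volume : Measure (EuclideanSpace ℝ d)).toSphere).prod ((volume : Measure ℝ).restrict (Ioc a (a + δ))))))) := by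
  haveI hXE : SigmaFinite (volume : Measure (UnitAddTorus d × EuclideanSpace ℝ d)) := inferInstance
  haveI hC : SigmaFinite (volume : Measure (Config n d (UnitAddTorus d))) := inferInstance
  haveI hσf : IsFiniteMeasure ((volume : Measure (EuclideanSpace ℝ d)).toSphere) := inferInstance
  have hpre : (fun x : ℝ => x + a) ⁻¹' Ioc a (a + δ) = Ioc 0 δ := by
    ext x
    simp only [mem_preimage, mem_Ioc]
    constructor <;> rintro ⟨h1, h2⟩ <;> constructor <;> linarith
  have htrans : MeasurePreserving (fun x : ℝ => x + a) ((volume : Measure ℝ).restrict (Ioc 0 δ)) ((volume : Measure ℝ).restrict (Ioc a (a + δ))) := by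
    have h := (measurePreserving_add_right (volume : Measure ℝ) a).restrict_preimage (measurableSet_Ioc (a := a) (b := a + δ))
    rwa [hpre] at h
  exact (MeasurePreserving.id ((volume : Measure (Config n d (UnitAddTorus d))).prod (volume : Measure (EuclideanSpace ℝ d)))).prod
    ((MeasurePreserving.id ((volume : Measure (EuclideanSpace ℝ d)).toSphere)).prod htrans)

omit [Fintype d] in
/-- The time shift of the collision coordinates is a measurable embedding (a measurable
equivalence). [folklore] -/
theorem measurableEmbedding_timeShift [Fintype d] {n : ℕ} (a : ℝ) :
    MeasurableEmbedding (fun p : (Config n d (UnitAddTorus d) × EuclideanSpace ℝ d) × (sphere (0 : EuclideanSpace ℝ d) 1 × ℝ) => (p.1, (p.2.1, p.2.2 + a))) := by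
  set e : (Config n d (UnitAddTorus d) × EuclideanSpace ℝ d) × (sphere (0 : EuclideanSpace ℝ d) 1 × ℝ) ≃ᵐ (Config n d (UnitAddTorus d) × EuclideanSpace ℝ d) × (sphere (0 : EuclideanSpace ℝ d) 1 × ℝ) :=
    MeasurableEquiv.prodCongr (MeasurableEquiv.refl _) (MeasurableEquiv.prodCongr (MeasurableEquiv.refl _) (MeasurableEquiv.addRight a))
    with he
  have hecoe : (e : (Config n d (UnitAddTorus d) × EuclideanSpace ℝ d) × (sphere (0 : EuclideanSpace ℝ d) 1 × ℝ) → (Config n d (UnitAddTorus d) × EuclideanSpace ℝ d) × (sphere (0 : EuclideanSpace ℝ d) 1 × ℝ)) = fun p => (p.1, (p.2.1, p.2.2 + a)) := by funext p; rfl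
  rw [← hecoe]
  exact e.measurableEmbedding

/-- **Translating the time coordinate of the collision coordinates**: for every real function
`f` on `((Z', v), (ν, τ))`, `∫ f(·, τ + a) dμ_{(0, δ]} = ∫ f dμ_{(a, a + δ]}`, where `μ_S` is the
product of Lebesgue measure in `(Z', v)`, the surface measure in `ν` and Lebesgue measure on `S`
in `τ`. [folklore] -/
theorem integral_comp_timeShift {n : ℕ} (a δ : ℝ) (f : (Config n d (UnitAddTorus d) × EuclideanSpace ℝ d) × (sphere (0 : EuclideanSpace ℝ d) 1 × ℝ) → ℝ) :
    ∫ p, f (p.1, (p.2.1, p.2.2 + a)) ∂((((volume : Measure (Config n d (UnitAddTorus d))).prod (volume : Measure (EuclideanSpace ℝ d))).prod ((((volume : Measure (EuclideanSpace ℝ d)).toSphere).prod ((volume : Measure ℝ).restrict (Ioc 0 δ)))))) = ∫ p, f p ∂((((volume : Measure (Config n d (UnitAddTorus d))).prod (volume : Measure (EuclideanSpace ℝ d))).prod ((((volume : Measure (EuclideanSpace ℝ d)).toSphere).prod ((volume : Measure ℝ).restrict (Ioc a (a + δ))))))) :=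
  (measurePreserving_timeShift a δ).integral_comp (measurableEmbedding_timeShift a) f

/-- **Additivity over consecutive time windows**: for `δ ≥ 0` and `f` integrable for the
collision coordinates with time in each window `(jδ, (j+1)δ]`, `j < N`, `f` is integrable for
the time interval `(0, Nδ]` and `∑_{j<N} ∫ f dμ_{(jδ, (j+1)δ]} = ∫ f dμ_{(0, Nδ]}`. [folklore] -/
theorem sum_integral_timeWindows {n : ℕ} {δ : ℝ} (hδ : 0 ≤ δ) (N : ℕ) (f : (Config n d (UnitAddTorus d) × EuclideanSpace ℝ d) × (sphere (0 : EuclideanSpace ℝ d) 1 × ℝ) → ℝ)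
    (hf : ∀ j : ℕ, j < N → Integrable f (((((volume : Measure (Config n d (UnitAddTorus d))).prod (volume : Measure (EuclideanSpace ℝ d))).prod ((((volume : Measure (EuclideanSpace ℝ d)).toSphere).prod ((volume : Measure ℝ).restrict (Ioc (j * δ) ((j + 1) * δ))))))))) :
    Integrable f (((((volume : Measure (Config n d (UnitAddTorus d))).prod (volume : Measure (EuclideanSpace ℝ d))).prod ((((volume : Measure (EuclideanSpace ℝ d)).toSphere).prod ((volume : Measure ℝ).restrict (Ioc 0 (N * δ)))))))) ∧
    ∑ j ∈ Finset.range N, ∫ p, f p ∂(((((volume : Measure (Config n d (UnitAddTorus d))).prod (volume : Measure (EuclideanSpace ℝ d))).prod ((((volume : Measure (EuclideanSpace ℝ d)).toSphere).prod ((volume : Measure ℝ).restrict (Ioc (j * δ) ((j + 1) * δ)))))))) = ∫ p, f p ∂(((((volume : Measure (Config n d (UnitAddTorus d))).prod (volume : Measure (EuclideanSpace ℝ d))).prod ((((volume : Measure (EuclideanSpace ℝ d)).toSphere).prod ((volume : Measure ℝ).restrict (Ioc 0 (N * δ)))))))) := by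
  haveI hXE : SigmaFinite (volume : Measure (UnitAddTorus d × EuclideanSpace ℝ d)) := inferInstance
  haveI hC : SigmaFinite (volume : Measure (Config n d (UnitAddTorus d))) := inferInstance
  haveI hσf : IsFiniteMeasure ((volume : Measure (EuclideanSpace ℝ d)).toSphere) := inferInstance
  set μ : Set ℝ → Measure ((Config n d (UnitAddTorus d) × EuclideanSpace ℝ d) × (sphere (0 : EuclideanSpace ℝ d) 1 × ℝ)) := fun S =>
    (((volume : Measure (Config n d (UnitAddTorus d))).prod (volume : Measure (EuclideanSpace ℝ d))).prod
      ((((volume : Measure (EuclideanSpace ℝ d)).toSphere).prod ((volume : Measure ℝ).restrict S)))) with hμ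
  have hadd : ∀ {S T : Set ℝ}, Disjoint S T → MeasurableSet T → μ (S ∪ T) = μ S + μ T := by
    intro S T hST hT
    simp only [hμ]
    rw [Measure.restrict_union hST hT, Measure.prod_add, Measure.prod_add]
  show Integrable f (μ (Ioc 0 (N * δ))) ∧ ∑ j ∈ Finset.range N, ∫ p, f p ∂μ (Ioc (j * δ) ((j + 1) * δ)) = ∫ p, f p ∂μ (Ioc 0 (N * δ))
  have hf' : ∀ j : ℕ, j < N → Integrable f (μ (Ioc (j * δ) ((j + 1) * δ))) := hf
  have key : ∀ M : ℕ, M ≤ N → Integrable f (μ (Ioc 0 (M * δ))) ∧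
      ∑ j ∈ Finset.range M, ∫ p, f p ∂μ (Ioc (j * δ) ((j + 1) * δ)) = ∫ p, f p ∂μ (Ioc 0 (M * δ)) := by
    intro M hM
    induction M with
    | zero =>
      constructor
      · simp only [Nat.cast_zero, zero_mul, Ioc_self, hμ, Measure.restrict_empty, Measure.prod_zero]
        exact integrable_zero_measure
      · simp [hμ]
    | succ M ih =>
      have hMN : M < N := Nat.lt_of_succ_le hM
      obtain ⟨hiM, hsumM⟩ := ih hMN.le
      have hunion : Ioc (0 : ℝ) ((M + 1 : ℕ) * δ) = Ioc 0 (M * δ) ∪ Ioc (M * δ) ((M + 1) * δ) := by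
        rw [Nat.cast_succ, Ioc_union_Ioc_eq_Ioc]
        · positivity
        · nlinarith
      have hdisj : Disjoint (Ioc (0 : ℝ) (M * δ)) (Ioc (M * δ) ((M + 1) * δ)) :=
        Set.disjoint_left.2 fun x hx hx' => (not_lt.2 hx.2) hx'.1
      have hiM1 : Integrable f (μ (Ioc (M * δ) ((M + 1) * δ))) := hf' M hMN
      rw [hunion, hadd hdisj measurableSet_Ioc]
      refine ⟨hiM.add_measure hiM1, ?_⟩
      rw [Finset.sum_range_succ, hsumM, integral_add_measure hiM hiM1]
  exact key N le_rfl

omit [Fintype d] in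
/-- Telescoping of the window increments. [folklore] -/
theorem sum_range_increment (F : ℝ → ℝ) (δ : ℝ) (N : ℕ) :
    ∑ j ∈ Finset.range N, (F ((j + 1) * δ) - F (j * δ)) = F (N * δ) - F 0 := by
  induction N with
  | zero => simp
  | succ N ih =>
    rw [Finset.sum_range_succ, ih]
    push_cast
    ring

end Plumbing

section EventSide

variable {ε : ℝ} (hε : 0 < ε) (hε' : ε < 2⁻¹)

include hε hε' in
/-- **The event-side integrand of `event_term_eq_flux` is integrable**: on the single-collision
event, `|H(t₁(z), w_out(z))| ≤ |W(Φ_{-a} z)|` (`regFlow_collisionInstant_eq_of_mem`), and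
`W ∘ Φ_{-a}` is integrable (`measurePreserving_regFlow_volume`). [folklore] -/
theorem integrable_eventSide {k m' : ℕ} [NeZero k] (i : Fin k) (a δ V : ℝ)
    {B : Set (Config k d (UnitAddTorus d))} (hB : MeasurableSet B)
    {W : Config (k + (m' + 1)) d (UnitAddTorus d) → ℝ} (hW : Measurable W) (hWi : Integrable W)
    (Gen : Set (Config (k + (m' + 1)) d (UnitAddTorus d)))
    (hGen : Gen = {w | (w ∘ Fin.castAdd (m' + 1) : Config k d (UnitAddTorus d)) ∈ Alexander.good (Torus.geometry d) ε ∧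
      ENNReal.ofReal δ < Alexander.freeExitTime (Torus.geometry d) ε (w ∘ Fin.castAdd (m' + 1) : Config k d (UnitAddTorus d)) ∧
      (collidePair (Torus.geometry d) (Fin.castAdd (m' + 1) i) (Fin.natAdd k (Fin.last m')) w ∘ Fin.castAdd (m' + 1) :
        Config k d (UnitAddTorus d)) ∈ Alexander.good (Torus.geometry d) ε ∧
      ENNReal.ofReal δ < Alexander.freeExitTime (Torus.geometry d) ε
        (flipVel (collidePair (Torus.geometry d) (Fin.castAdd (m' + 1) i) (Fin.natAdd k (Fin.last m')) w ∘ Fin.castAdd (m' + 1) :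
          Config k d (UnitAddTorus d)))})
    (H : ℝ → Config (k + (m' + 1)) d (UnitAddTorus d) → ℝ)
    (hHdef : H = fun τ w => Gen.indicator (fun w =>
      ((Alexander.regFlow (Torus.geometry d) ε (a + τ) '' B).indicator (1 : Config k d (UnitAddTorus d) → ℝ)
          (w ∘ Fin.castAdd (m' + 1)) -
        (Alexander.regFlow (Torus.geometry d) ε (a + τ) '' B).indicator (1 : Config k d (UnitAddTorus d) → ℝ)
          (collidePair (Torus.geometry d) (Fin.castAdd (m' + 1) i) (Fin.natAdd k (Fin.last m')) w ∘ Fin.castAdd (m' + 1))) *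
      W (Alexander.regFlow (Torus.geometry d) ε (-(a + τ)) w)) w) :
    Integrable fun z : Config (k + m' + 1) d (UnitAddTorus d) =>
      (Alexander.singleCollisionEvent (Torus.geometry d) ε (Fin.castAdd 1 (Fin.castAdd m' i)) (Fin.natAdd (k + m') 0) δ).indicator
        (fun z => {z : Config (k + m' + 1) d (UnitAddTorus d) |
            ‖(z (Fin.natAdd (k + m') 0)).2 - (z (Fin.castAdd 1 (Fin.castAdd m' i))).2‖ ≤ V}.indicator
          (fun z => H (Alexander.collisionInstant (Torus.geometry d) ε z 1).toReal
            (outRep (Torus.geometry d) (k + m') (Fin.castAdd m' i)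
              (freeFlight (Torus.geometry d) (Alexander.collisionInstant (Torus.geometry d) ε z 1).toReal z))) z) z := by
  classical
  have hG := Torus.isHardSphereRegular_geometry (d := d) hε'
  have hGm := Torus.isMeasurable_geometry (d := d)
  set I : Fin (k + (m' + 1)) := Fin.castAdd (m' + 1) i with hI
  set L : Fin (k + (m' + 1)) := Fin.natAdd k (Fin.last m') with hL
  set i' : Fin (k + m') := Fin.castAdd m' i with hi'
  have hI' : (Fin.castAdd 1 i' : Fin (k + m' + 1)) = I := Fin.ext rfl
  have hL' : (Fin.natAdd (k + m') 0 : Fin (k + m' + 1)) = L := Fin.ext (by simp [hL])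
  have hIL : I ≠ L := by intro h; have := congrArg Fin.val h; simp [hI, hL] at this; omega
  have houtRep : ∀ w : Config (k + (m' + 1)) d (UnitAddTorus d), outRep (Torus.geometry d) (k + m') i' w = collidePair (Torus.geometry d) I L w := by
    intro w; unfold outRep; rw [hI', hL']
  simp only [hI', hL', houtRep]
  set E := Alexander.singleCollisionEvent (Torus.geometry d) ε I L δ with hE
  set t₁ : Config (k + (m' + 1)) d (UnitAddTorus d) → ℝ := fun z => (Alexander.collisionInstant (Torus.geometry d) ε z 1).toReal with ht₁
  set cP := collidePair (Torus.geometry d) I L with hcP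
  set wout : Config (k + (m' + 1)) d (UnitAddTorus d) → Config (k + (m' + 1)) d (UnitAddTorus d) := fun z => cP (freeFlight (Torus.geometry d) (t₁ z) z) with hwout
  set Sl : Set (Config (k + (m' + 1)) d (UnitAddTorus d)) := {z | ‖(z L).2 - (z I).2‖ ≤ V} with hSl
  -- measurability
  have hGenm : MeasurableSet Gen := by rw [hGen]; exact measurableSet_gen hε' I L δ
  have hHm : Measurable fun p : ℝ × Config (k + (m' + 1)) d (UnitAddTorus d) => H p.1 p.2 := by
    rw [hHdef]; exact measurable_eventIntegrand hε hε' I L a hB hW hGenm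
  have ht₁m : Measurable t₁ := (Alexander.measurable_collisionInstant hG hGm 1).ennreal_toReal
  have hcPm : Measurable cP := hGm.measurable_collidePair I L
  have hwoutm : Measurable wout := hcPm.comp (hGm.measurable_freeFlight₂.comp (ht₁m.prodMk measurable_id))
  have hHzm : Measurable fun z : Config (k + (m' + 1)) d (UnitAddTorus d) => H (t₁ z) (wout z) := hHm.comp (ht₁m.prodMk hwoutm)
  have hEm : MeasurableSet E := Alexander.measurableSet_singleCollisionEvent hG hGm (Alexander.measurableSet_good hG hGm) _ _ δ
  have hSlm : MeasurableSet Sl :=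
    measurableSet_le (((measurable_pi_apply _).snd.sub (measurable_pi_apply _).snd).norm) measurable_const
  -- the bound `|H(t₁ z, w_out z)| ≤ |W(Φ_{-a} z)|` on the event
  have hind1 : ∀ (S : Set (Config k d (UnitAddTorus d))) (y : Config k d (UnitAddTorus d)),
      0 ≤ S.indicator (1 : Config k d (UnitAddTorus d) → ℝ) y ∧ S.indicator (1 : Config k d (UnitAddTorus d) → ℝ) y ≤ 1 := by
    intro S y
    by_cases h : y ∈ S
    · rw [indicator_of_mem h, Pi.one_apply]; exact ⟨zero_le_one, le_rfl⟩
    · rw [indicator_of_notMem h]; exact ⟨le_rfl, zero_le_one⟩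
  have hHle : ∀ τ w, |H τ w| ≤ |W (Alexander.regFlow (Torus.geometry d) ε (-(a + τ)) w)| := by
    intro τ w
    rw [hHdef]
    simp only
    by_cases hw : w ∈ Gen
    · rw [indicator_of_mem hw, abs_mul]
      refine mul_le_of_le_one_left (abs_nonneg _) ?_
      have h1 := hind1 (Alexander.regFlow (Torus.geometry d) ε (a + τ) '' B) (w ∘ Fin.castAdd (m' + 1))
      have h2 := hind1 (Alexander.regFlow (Torus.geometry d) ε (a + τ) '' B)
        (collidePair (Torus.geometry d) (Fin.castAdd (m' + 1) i) (Fin.natAdd k (Fin.last m')) w ∘ Fin.castAdd (m' + 1))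
      rw [abs_le]; constructor <;> linarith [h1.1, h1.2, h2.1, h2.2]
    · rw [indicator_of_notMem hw, abs_zero]; exact abs_nonneg _
  have hWai : Integrable fun z : Config (k + (m' + 1)) d (UnitAddTorus d) => W (Alexander.regFlow (Torus.geometry d) ε (-a) z) :=
    ((measurePreserving_regFlow_volume hε hε' (-a)).integrable_comp hWi.aestronglyMeasurable).2 hWi
  refine Integrable.mono' hWai.abs ((hHzm.indicator hSlm).indicator hEm).aestronglyMeasurable (Filter.Eventually.of_forall fun z => ?_)
  rw [Real.norm_eq_abs]
  by_cases hz : z ∈ E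
  · rw [indicator_of_mem hz]
    by_cases hs : ‖(z L).2 - (z I).2‖ ≤ V
    · rw [Set.indicator_apply, if_pos (Set.mem_setOf_eq ▸ hs)]
      have hflow : Alexander.regFlow (Torus.geometry d) ε (t₁ z) z = wout z := regFlow_collisionInstant_eq_of_mem hε' hIL hz
      have hWa' : W (Alexander.regFlow (Torus.geometry d) ε (-a) z) = W (Alexander.regFlow (Torus.geometry d) ε (-(a + t₁ z)) (wout z)) := by
        rw [← hflow, ← Alexander.regFlow_add hε hε', show -(a + t₁ z) + t₁ z = -a by ring]
      rw [hWa']; exact hHle _ _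
    · rw [Set.indicator_apply, if_neg (show z ∉ {y : Config (k + m' + 1) d (UnitAddTorus d) | ‖(y L).2 - (y I).2‖ ≤ V} from hs), abs_zero]
      exact abs_nonneg _
  · rw [indicator_of_notMem hz, abs_zero]; exact abs_nonneg _

end EventSide

section Sum

variable {ε : ℝ} (hε : 0 < ε) (hε' : ε < 2⁻¹)

set_option maxHeartbeats 1000000 in
include hε hε' in
/-- **The window decomposition summed over the windows** (CIP 1994 App. 4.B). For `N` windows of
length `δ > 0` with `ε + δ V ≤ ρ < 1/2`, a measurable set `B` of good tagged configurations and an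
integrable measurable weight `W` symmetric in the untagged labels: the increment over `(0, Nδ]`
of `∫_{good} 1_{Φ^k_s B}(π Φ_s z₀) W(z₀) dz₀` equals `m` times the sum over the tagged labels of
the integral, over the collision coordinates with absolute collision time `τ' ∈ (0, Nδ]`, of the
window integrand of `event_term_eq_flux` for the window starting at `δ(⌈τ'/δ⌉ - 1)`, up to the
dirty windows and the summed cut-off errors (`window_increment_decomposition`,
`integral_comp_timeShift`, `sum_integral_timeWindows`). [cite: CIP1994, App. 4.B] -/
theorem sum_window_decomposition [Nonempty d] [DecidableEq d] {k m' : ℕ} [NeZero k] {δ V ρ : ℝ} (hδ : 0 < δ) (N : ℕ)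
    (hρ : ρ < 1 / 2) (hδV : ε + δ * V ≤ ρ)
    {B : Set (Config k d (UnitAddTorus d))} (hB : MeasurableSet B) (hBg : B ⊆ Alexander.good (Torus.geometry d) ε)
    {W : Config (k + (m' + 1)) d (UnitAddTorus d) → ℝ} (hW : Measurable W) (hWi : Integrable W)
    (hWσ : ∀ (J : Fin (m' + 1)) (z : Config (k + (m' + 1)) d (UnitAddTorus d)),
      W (z ∘ Equiv.swap (Fin.natAdd k J) (Fin.natAdd k (Fin.last m')) : Config (k + (m' + 1)) d (UnitAddTorus d)) = W z) :
    |((∫ z₀ in Alexander.good (Torus.geometry d) ε,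
          (Alexander.regFlow (Torus.geometry d) ε (N * δ) '' B).indicator (1 : Config k d (UnitAddTorus d) → ℝ) (Alexander.regFlow (Torus.geometry d) ε (N * δ) z₀ ∘ Fin.castAdd (m' + 1)) * W z₀) -
        ∫ z₀ in Alexander.good (Torus.geometry d) ε, (Alexander.regFlow (Torus.geometry d) ε (0) '' B).indicator (1 : Config k d (UnitAddTorus d) → ℝ) (z₀ ∘ Fin.castAdd (m' + 1)) * W z₀) -
      (m' + 1 : ℝ) * ∑ i : Fin k, ∫ p, ε ^ (Fintype.card d - 1) * max ⟪p.1.2 - (p.1.1 (Fin.castAdd m' i)).2, (p.2.1 : EuclideanSpace ℝ d)⟫_ℝ 0 *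
          {v : EuclideanSpace ℝ d | ‖v - (p.1.1 (Fin.castAdd m' i)).2‖ ≤ V}.indicator (1 : EuclideanSpace ℝ d → ℝ) p.1.2 *
          (Alexander.singleCollisionEvent (Torus.geometry d) ε (Fin.castAdd 1 (Fin.castAdd m' i)) (Fin.natAdd (k + m') 0) δ).indicator
            (1 : Config (k + m' + 1) d (UnitAddTorus d) → ℝ)
            (freeFlight (Torus.geometry d) (-(p.2.2 - (δ * ((⌈p.2.2 / δ⌉ : ℤ) - 1 : ℝ)))) (gainConfig (Torus.geometry d) ε p.1.1 (Fin.castAdd m' i) p.2.1 p.1.2)) *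
          ({w : Config (k + (m' + 1)) d (UnitAddTorus d) | (w ∘ Fin.castAdd (m' + 1) : Config k d (UnitAddTorus d)) ∈ Alexander.good (Torus.geometry d) ε ∧
            ENNReal.ofReal δ < Alexander.freeExitTime (Torus.geometry d) ε (w ∘ Fin.castAdd (m' + 1) : Config k d (UnitAddTorus d)) ∧
            (collidePair (Torus.geometry d) (Fin.castAdd (m' + 1) i) (Fin.natAdd k (Fin.last m')) w ∘ Fin.castAdd (m' + 1) : Config k d (UnitAddTorus d)) ∈ Alexander.good (Torus.geometry d) ε ∧
            ENNReal.ofReal δ < Alexander.freeExitTime (Torus.geometry d) ε (flipVel (collidePair (Torus.geometry d) (Fin.castAdd (m' + 1) i) (Fin.natAdd k (Fin.last m')) w ∘ Fin.castAdd (m' + 1) : Config k d (UnitAddTorus d)))}).indicator (fun w =>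
            ((Alexander.regFlow (Torus.geometry d) ε (p.2.2) '' B).indicator (1 : Config k d (UnitAddTorus d) → ℝ) (w ∘ Fin.castAdd (m' + 1)) -
              (Alexander.regFlow (Torus.geometry d) ε (p.2.2) '' B).indicator (1 : Config k d (UnitAddTorus d) → ℝ) (collidePair (Torus.geometry d) (Fin.castAdd (m' + 1) i) (Fin.natAdd k (Fin.last m')) w ∘ Fin.castAdd (m' + 1))) *
            W (Alexander.regFlow (Torus.geometry d) ε (-p.2.2) w)) (lossConfig (Torus.geometry d) ε p.1.1 (Fin.castAdd m' i) p.2.1 p.1.2)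
        ∂((((volume : Measure (Config (k + m') d (UnitAddTorus d))).prod (volume : Measure (EuclideanSpace ℝ d))).prod ((((volume : Measure (EuclideanSpace ℝ d)).toSphere).prod ((volume : Measure ℝ).restrict (Ioc 0 (N * δ)))))))| ≤
      2 * (∫ z₀ in Alexander.good (Torus.geometry d) ε,
        (∑ j ∈ Finset.range N, {z₀ : Config (k + (m' + 1)) d (UnitAddTorus d) |
          Alexander.collisionCount (Torus.geometry d) ε z₀ (j * δ) + 2 ≤ Alexander.collisionCount (Torus.geometry d) ε z₀ (j * δ + δ)}.indicator
            (1 : Config (k + (m' + 1)) d (UnitAddTorus d) → ℝ) z₀) * |W z₀|) +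
      (m' + 1 : ℝ) * ∑ i : Fin k, ∑ j ∈ Finset.range N,
        ∫ z, (Alexander.singleCollisionEvent (Torus.geometry d) ε (Fin.castAdd (m' + 1) i) (Fin.natAdd k (Fin.last m')) δ).indicator
            (1 : Config (k + (m' + 1)) d (UnitAddTorus d) → ℝ) z *
          (({z : Config (k + (m' + 1)) d (UnitAddTorus d) |
                V < ‖(z (Fin.natAdd k (Fin.last m'))).2 - (z (Fin.castAdd (m' + 1) i)).2‖}.indicator
                (1 : Config (k + (m' + 1)) d (UnitAddTorus d) → ℝ) z +
              2 * ({w : Config (k + (m' + 1)) d (UnitAddTorus d) | (w ∘ Fin.castAdd (m' + 1) : Config k d (UnitAddTorus d)) ∈ Alexander.good (Torus.geometry d) ε ∧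
                  ENNReal.ofReal δ < Alexander.freeExitTime (Torus.geometry d) ε (w ∘ Fin.castAdd (m' + 1) : Config k d (UnitAddTorus d)) ∧
                  (collidePair (Torus.geometry d) (Fin.castAdd (m' + 1) i) (Fin.natAdd k (Fin.last m')) w ∘ Fin.castAdd (m' + 1) : Config k d (UnitAddTorus d)) ∈ Alexander.good (Torus.geometry d) ε ∧
                  ENNReal.ofReal δ < Alexander.freeExitTime (Torus.geometry d) ε (flipVel (collidePair (Torus.geometry d) (Fin.castAdd (m' + 1) i) (Fin.natAdd k (Fin.last m')) w ∘ Fin.castAdd (m' + 1) : Config k d (UnitAddTorus d)))})ᶜ.indicator (1 : Config (k + (m' + 1)) d (UnitAddTorus d) → ℝ)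
                (collidePair (Torus.geometry d) (Fin.castAdd (m' + 1) i) (Fin.natAdd k (Fin.last m'))
                  (freeFlight (Torus.geometry d) (Alexander.collisionInstant (Torus.geometry d) ε z 1).toReal z))) *
            |W (Alexander.regFlow (Torus.geometry d) ε (-(j * δ)) z)|) := by
  classical
  haveI hXE : SigmaFinite (volume : Measure (UnitAddTorus d × EuclideanSpace ℝ d)) := inferInstance
  haveI hC : SigmaFinite (volume : Measure (Config (k + m') d (UnitAddTorus d))) := inferInstance
  haveI hσf : IsFiniteMeasure ((volume : Measure (EuclideanSpace ℝ d)).toSphere) := inferInstance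
  haveI : NeZero (k + m') := ⟨by have := NeZero.ne k; omega⟩
  have hG := Torus.isHardSphereRegular_geometry (d := d) hε'
  have hGm := Torus.isMeasurable_geometry (d := d)
  -- the generic sets and the window integrands
  set GenS : Fin k → Set (Config (k + (m' + 1)) d (UnitAddTorus d)) := fun i => {w : Config (k + (m' + 1)) d (UnitAddTorus d) | (w ∘ Fin.castAdd (m' + 1) : Config k d (UnitAddTorus d)) ∈ Alexander.good (Torus.geometry d) ε ∧
    ENNReal.ofReal δ < Alexander.freeExitTime (Torus.geometry d) ε (w ∘ Fin.castAdd (m' + 1) : Config k d (UnitAddTorus d)) ∧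
    (collidePair (Torus.geometry d) (Fin.castAdd (m' + 1) i) (Fin.natAdd k (Fin.last m')) w ∘ Fin.castAdd (m' + 1) : Config k d (UnitAddTorus d)) ∈ Alexander.good (Torus.geometry d) ε ∧
    ENNReal.ofReal δ < Alexander.freeExitTime (Torus.geometry d) ε (flipVel (collidePair (Torus.geometry d) (Fin.castAdd (m' + 1) i) (Fin.natAdd k (Fin.last m')) w ∘ Fin.castAdd (m' + 1) : Config k d (UnitAddTorus d)))} with hGenS
  set Hj : ℕ → Fin k → ℝ → Config (k + (m' + 1)) d (UnitAddTorus d) → ℝ := fun (j : ℕ) (i : Fin k) (τ : ℝ) (w : Config (k + (m' + 1)) d (UnitAddTorus d)) => ({w : Config (k + (m' + 1)) d (UnitAddTorus d) | (w ∘ Fin.castAdd (m' + 1) : Config k d (UnitAddTorus d)) ∈ Alexander.good (Torus.geometry d) ε ∧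
      ENNReal.ofReal δ < Alexander.freeExitTime (Torus.geometry d) ε (w ∘ Fin.castAdd (m' + 1) : Config k d (UnitAddTorus d)) ∧
      (collidePair (Torus.geometry d) (Fin.castAdd (m' + 1) i) (Fin.natAdd k (Fin.last m')) w ∘ Fin.castAdd (m' + 1) : Config k d (UnitAddTorus d)) ∈ Alexander.good (Torus.geometry d) ε ∧
      ENNReal.ofReal δ < Alexander.freeExitTime (Torus.geometry d) ε (flipVel (collidePair (Torus.geometry d) (Fin.castAdd (m' + 1) i) (Fin.natAdd k (Fin.last m')) w ∘ Fin.castAdd (m' + 1) : Config k d (UnitAddTorus d)))}).indicator (fun w =>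
      ((Alexander.regFlow (Torus.geometry d) ε (j * δ + τ) '' B).indicator (1 : Config k d (UnitAddTorus d) → ℝ) (w ∘ Fin.castAdd (m' + 1)) -
        (Alexander.regFlow (Torus.geometry d) ε (j * δ + τ) '' B).indicator (1 : Config k d (UnitAddTorus d) → ℝ) (collidePair (Torus.geometry d) (Fin.castAdd (m' + 1) i) (Fin.natAdd k (Fin.last m')) w ∘ Fin.castAdd (m' + 1))) *
      W (Alexander.regFlow (Torus.geometry d) ε (-(j * δ + τ)) w)) w with hHj
  set μ : Set ℝ → Measure ((Config (k + m') d (UnitAddTorus d) × EuclideanSpace ℝ d) × (sphere (0 : EuclideanSpace ℝ d) 1 × ℝ)) := fun S =>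
    (((volume : Measure (Config (k + m') d (UnitAddTorus d))).prod (volume : Measure (EuclideanSpace ℝ d))).prod
      ((((volume : Measure (EuclideanSpace ℝ d)).toSphere).prod ((volume : Measure ℝ).restrict S)))) with hμ
  set g : ℕ → Fin k → (Config (k + m') d (UnitAddTorus d) × EuclideanSpace ℝ d) × (sphere (0 : EuclideanSpace ℝ d) 1 × ℝ) → ℝ := fun j i p => ε ^ (Fintype.card d - 1) * max ⟪p.1.2 - (p.1.1 (Fin.castAdd m' i)).2, (p.2.1 : EuclideanSpace ℝ d)⟫_ℝ 0 *
          {v : EuclideanSpace ℝ d | ‖v - (p.1.1 (Fin.castAdd m' i)).2‖ ≤ V}.indicator (1 : EuclideanSpace ℝ d → ℝ) p.1.2 *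
          (Alexander.singleCollisionEvent (Torus.geometry d) ε (Fin.castAdd 1 (Fin.castAdd m' i)) (Fin.natAdd (k + m') 0) δ).indicator
            (1 : Config (k + m' + 1) d (UnitAddTorus d) → ℝ)
            (freeFlight (Torus.geometry d) (-p.2.2) (gainConfig (Torus.geometry d) ε p.1.1 (Fin.castAdd m' i) p.2.1 p.1.2)) *
          Hj j i p.2.2 (lossConfig (Torus.geometry d) ε p.1.1 (Fin.castAdd m' i) p.2.1 p.1.2) with hg
  set G : Fin k → (Config (k + m') d (UnitAddTorus d) × EuclideanSpace ℝ d) × (sphere (0 : EuclideanSpace ℝ d) 1 × ℝ) → ℝ := fun i p => ε ^ (Fintype.card d - 1) * max ⟪p.1.2 - (p.1.1 (Fin.castAdd m' i)).2, (p.2.1 : EuclideanSpace ℝ d)⟫_ℝ 0 *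
          {v : EuclideanSpace ℝ d | ‖v - (p.1.1 (Fin.castAdd m' i)).2‖ ≤ V}.indicator (1 : EuclideanSpace ℝ d → ℝ) p.1.2 *
          (Alexander.singleCollisionEvent (Torus.geometry d) ε (Fin.castAdd 1 (Fin.castAdd m' i)) (Fin.natAdd (k + m') 0) δ).indicator
            (1 : Config (k + m' + 1) d (UnitAddTorus d) → ℝ)
            (freeFlight (Torus.geometry d) (-(p.2.2 - (δ * ((⌈p.2.2 / δ⌉ : ℤ) - 1 : ℝ)))) (gainConfig (Torus.geometry d) ε p.1.1 (Fin.castAdd m' i) p.2.1 p.1.2)) *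
          ({w : Config (k + (m' + 1)) d (UnitAddTorus d) | (w ∘ Fin.castAdd (m' + 1) : Config k d (UnitAddTorus d)) ∈ Alexander.good (Torus.geometry d) ε ∧
            ENNReal.ofReal δ < Alexander.freeExitTime (Torus.geometry d) ε (w ∘ Fin.castAdd (m' + 1) : Config k d (UnitAddTorus d)) ∧
            (collidePair (Torus.geometry d) (Fin.castAdd (m' + 1) i) (Fin.natAdd k (Fin.last m')) w ∘ Fin.castAdd (m' + 1) : Config k d (UnitAddTorus d)) ∈ Alexander.good (Torus.geometry d) ε ∧
            ENNReal.ofReal δ < Alexander.freeExitTime (Torus.geometry d) ε (flipVel (collidePair (Torus.geometry d) (Fin.castAdd (m' + 1) i) (Fin.natAdd k (Fin.last m')) w ∘ Fin.castAdd (m' + 1) : Config k d (UnitAddTorus d)))}).indicator (fun w =>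
            ((Alexander.regFlow (Torus.geometry d) ε (p.2.2) '' B).indicator (1 : Config k d (UnitAddTorus d) → ℝ) (w ∘ Fin.castAdd (m' + 1)) -
              (Alexander.regFlow (Torus.geometry d) ε (p.2.2) '' B).indicator (1 : Config k d (UnitAddTorus d) → ℝ) (collidePair (Torus.geometry d) (Fin.castAdd (m' + 1) i) (Fin.natAdd k (Fin.last m')) w ∘ Fin.castAdd (m' + 1))) *
            W (Alexander.regFlow (Torus.geometry d) ε (-p.2.2) w)) (lossConfig (Torus.geometry d) ε p.1.1 (Fin.castAdd m' i) p.2.1 p.1.2) with hGdef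
  set F : ℝ → ℝ := fun t => ∫ z₀ in Alexander.good (Torus.geometry d) ε,
    (Alexander.regFlow (Torus.geometry d) ε t '' B).indicator (1 : Config k d (UnitAddTorus d) → ℝ)
      (Alexander.regFlow (Torus.geometry d) ε t z₀ ∘ Fin.castAdd (m' + 1)) * W z₀ with hF
  set Dirty : ℕ → Set (Config (k + (m' + 1)) d (UnitAddTorus d)) := fun j => {z₀ |
    Alexander.collisionCount (Torus.geometry d) ε z₀ (j * δ) + 2 ≤ Alexander.collisionCount (Torus.geometry d) ε z₀ (j * δ + δ)} with hDirty
  set Err : ℕ → Fin k → ℝ := fun j i => ∫ z, (Alexander.singleCollisionEvent (Torus.geometry d) ε (Fin.castAdd (m' + 1) i) (Fin.natAdd k (Fin.last m')) δ).indicator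
            (1 : Config (k + (m' + 1)) d (UnitAddTorus d) → ℝ) z *
          (({z : Config (k + (m' + 1)) d (UnitAddTorus d) |
                V < ‖(z (Fin.natAdd k (Fin.last m'))).2 - (z (Fin.castAdd (m' + 1) i)).2‖}.indicator
                (1 : Config (k + (m' + 1)) d (UnitAddTorus d) → ℝ) z +
              2 * ({w : Config (k + (m' + 1)) d (UnitAddTorus d) | (w ∘ Fin.castAdd (m' + 1) : Config k d (UnitAddTorus d)) ∈ Alexander.good (Torus.geometry d) ε ∧
                  ENNReal.ofReal δ < Alexander.freeExitTime (Torus.geometry d) ε (w ∘ Fin.castAdd (m' + 1) : Config k d (UnitAddTorus d)) ∧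
                  (collidePair (Torus.geometry d) (Fin.castAdd (m' + 1) i) (Fin.natAdd k (Fin.last m')) w ∘ Fin.castAdd (m' + 1) : Config k d (UnitAddTorus d)) ∈ Alexander.good (Torus.geometry d) ε ∧
                  ENNReal.ofReal δ < Alexander.freeExitTime (Torus.geometry d) ε (flipVel (collidePair (Torus.geometry d) (Fin.castAdd (m' + 1) i) (Fin.natAdd k (Fin.last m')) w ∘ Fin.castAdd (m' + 1) : Config k d (UnitAddTorus d)))})ᶜ.indicator (1 : Config (k + (m' + 1)) d (UnitAddTorus d) → ℝ)
                (collidePair (Torus.geometry d) (Fin.castAdd (m' + 1) i) (Fin.natAdd k (Fin.last m'))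
                  (freeFlight (Torus.geometry d) (Alexander.collisionInstant (Torus.geometry d) ε z 1).toReal z))) *
            |W (Alexander.regFlow (Torus.geometry d) ε (-(j * δ)) z)|) with hErr
  -- Step 1: the windows
  have hwin : ∀ j : ℕ, |(∫ z₀ in Alexander.good (Torus.geometry d) ε,
        ((Alexander.regFlow (Torus.geometry d) ε (j * δ + δ) '' B).indicator (1 : Config k d (UnitAddTorus d) → ℝ)
            (Alexander.regFlow (Torus.geometry d) ε (j * δ + δ) z₀ ∘ Fin.castAdd (m' + 1)) -
          (Alexander.regFlow (Torus.geometry d) ε (j * δ) '' B).indicator (1 : Config k d (UnitAddTorus d) → ℝ)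
            (Alexander.regFlow (Torus.geometry d) ε (j * δ) z₀ ∘ Fin.castAdd (m' + 1))) * W z₀) -
      (m' + 1 : ℝ) * ∑ i : Fin k, ∫ p, g j i p ∂μ (Ioc 0 δ)| ≤
      2 * (∫ z₀ in Alexander.good (Torus.geometry d) ε, (Dirty j).indicator (1 : Config (k + (m' + 1)) d (UnitAddTorus d) → ℝ) z₀ * |W z₀|) +
        (m' + 1 : ℝ) * ∑ i : Fin k, Err j i := by
    intro j
    have h := window_increment_decomposition hε hε' (k := k) (m' := m') (a := j * δ) (δ := δ) (V := V) (ρ := ρ)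
      (by positivity) hδ hρ hδV hB hBg hW hWi hWσ GenS (fun i => rfl) (Hj j) (fun i => rfl)
    simpa only [hg, hμ, hDirty, hErr, hGenS, hHj] using h
  -- Step 2: the increments telescope
  have himgm : ∀ t : ℝ, MeasurableSet (Alexander.regFlow (Torus.geometry d) ε t '' B) := by
    intro t
    have : Alexander.regFlow (Torus.geometry d) ε t '' B = (Alexander.regFlow (Torus.geometry d) ε (-t)) ⁻¹' B := by
      ext y; rw [Set.mem_preimage]; exact mem_image_regFlow_iff hε hε' t B y
    rw [this]; exact hB.preimage (Alexander.measurable_regFlow hε' _)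
  have hπ : Measurable fun w : Config (k + (m' + 1)) d (UnitAddTorus d) => (w ∘ Fin.castAdd (m' + 1) : Config k d (UnitAddTorus d)) :=
    measurable_pi_lambda _ fun j => measurable_pi_apply _
  have hψWi : ∀ t : ℝ, IntegrableOn (fun z₀ : Config (k + (m' + 1)) d (UnitAddTorus d) => (Alexander.regFlow (Torus.geometry d) ε t '' B).indicator (1 : Config k d (UnitAddTorus d) → ℝ)
      (Alexander.regFlow (Torus.geometry d) ε t z₀ ∘ Fin.castAdd (m' + 1)) * W z₀) (Alexander.good (Torus.geometry d) ε) := by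
    intro t
    refine Integrable.mono' hWi.integrableOn.abs ?_ (Filter.Eventually.of_forall fun z₀ => ?_)
    · exact (((measurable_const.indicator (himgm t)).comp (hπ.comp (Alexander.measurable_regFlow hε' t))).mul hW).aestronglyMeasurable
    · rw [Real.norm_eq_abs, abs_mul]
      refine mul_le_of_le_one_left (abs_nonneg _) ?_
      by_cases h : (Alexander.regFlow (Torus.geometry d) ε t z₀ ∘ Fin.castAdd (m' + 1) : Config k d (UnitAddTorus d)) ∈ Alexander.regFlow (Torus.geometry d) ε t '' B
      · rw [indicator_of_mem h, Pi.one_apply, abs_one]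
      · rw [indicator_of_notMem h, abs_zero]; exact zero_le_one
  have hInc : ∀ j : ℕ, (∫ z₀ in Alexander.good (Torus.geometry d) ε,
        ((Alexander.regFlow (Torus.geometry d) ε (j * δ + δ) '' B).indicator (1 : Config k d (UnitAddTorus d) → ℝ)
            (Alexander.regFlow (Torus.geometry d) ε (j * δ + δ) z₀ ∘ Fin.castAdd (m' + 1)) -
          (Alexander.regFlow (Torus.geometry d) ε (j * δ) '' B).indicator (1 : Config k d (UnitAddTorus d) → ℝ)
            (Alexander.regFlow (Torus.geometry d) ε (j * δ) z₀ ∘ Fin.castAdd (m' + 1))) * W z₀) = F (j * δ + δ) - F (j * δ) := by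
    intro j
    simp only [hF]
    rw [← integral_sub (hψWi _) (hψWi _)]
    refine integral_congr_ae (Filter.Eventually.of_forall fun z₀ => ?_)
    ring
  have htel : ∀ M : ℕ, ∑ j ∈ Finset.range M, (F (j * δ + δ) - F (j * δ)) = F (M * δ) - F 0 := by
    intro M
    induction M with
    | zero => simp
    | succ M ih =>
      rw [Finset.sum_range_succ, ih, Nat.cast_succ, add_mul, one_mul]
      ring
  have hF0 : F 0 = ∫ z₀ in Alexander.good (Torus.geometry d) ε,
      (Alexander.regFlow (Torus.geometry d) ε 0 '' B).indicator (1 : Config k d (UnitAddTorus d) → ℝ) (z₀ ∘ Fin.castAdd (m' + 1)) * W z₀ := by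
    simp only [hF, Alexander.regFlow_zero hε hε']
  -- Step 3: the flux windows over the absolute collision time
  have hae0 : ∀ᵐ p ∂μ (Ioc 0 δ), p.2.2 ∈ Ioc (0 : ℝ) δ := by
    have hnull : μ (Ioc 0 δ) {p : (Config (k + m') d (UnitAddTorus d) × EuclideanSpace ℝ d) × (sphere (0 : EuclideanSpace ℝ d) 1 × ℝ) | p.2.2 ∉ Ioc (0 : ℝ) δ} = 0 := by
      have hset : {p : (Config (k + m') d (UnitAddTorus d) × EuclideanSpace ℝ d) × (sphere (0 : EuclideanSpace ℝ d) 1 × ℝ) | p.2.2 ∉ Ioc (0 : ℝ) δ} =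
          (Set.univ : Set (Config (k + m') d (UnitAddTorus d) × EuclideanSpace ℝ d)) ×ˢ
            ((Set.univ : Set (sphere (0 : EuclideanSpace ℝ d) 1)) ×ˢ (Ioc (0 : ℝ) δ)ᶜ) := by
        ext p; simp
      simp only [hμ]
      rw [hset, Measure.prod_prod, Measure.prod_prod, Measure.restrict_apply (measurableSet_Ioc.compl), Set.compl_inter_self,
        measure_empty, mul_zero, mul_zero]
    rw [ae_iff]
    simpa using hnull
  have hceil : ∀ (j : ℕ) (τ : ℝ), τ ∈ Ioc (0 : ℝ) δ → (⌈(τ + j * δ) / δ⌉ : ℤ) = (j : ℤ) + 1 := by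
    intro j τ hτ
    rw [Int.ceil_eq_iff]
    push_cast
    constructor
    · rw [add_sub_cancel_right, lt_div_iff₀ hδ]; linarith [hτ.1]
    · rw [div_le_iff₀ hδ]; linarith [hτ.2]
  have hGeq : ∀ (j : ℕ) (i : Fin k) (p : (Config (k + m') d (UnitAddTorus d) × EuclideanSpace ℝ d) × (sphere (0 : EuclideanSpace ℝ d) 1 × ℝ)), p.2.2 ∈ Ioc (0 : ℝ) δ → g j i p = G i (p.1, (p.2.1, p.2.2 + j * δ)) := by
    intro j i p hp
    have hc := hceil j p.2.2 hp
    simp only [hg, hGdef, hHj]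
    rw [hc]
    have ht : -(p.2.2 + (j : ℝ) * δ - δ * ((((j : ℤ) + 1 : ℤ) : ℝ) - 1)) = -p.2.2 := by push_cast; ring
    rw [ht, add_comm p.2.2 ((j : ℝ) * δ)]
  have hHm : ∀ (j : ℕ) (i : Fin k), Measurable fun q : ℝ × Config (k + (m' + 1)) d (UnitAddTorus d) => Hj j i q.1 q.2 := by
    intro j i
    simp only [hHj]
    exact measurable_eventIntegrand hε hε' (Fin.castAdd (m' + 1) i) (Fin.natAdd k (Fin.last m')) (j * δ) hB hW
      (measurableSet_gen hε' (Fin.castAdd (m' + 1) i) (Fin.natAdd k (Fin.last m')) δ)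
  have hgi : ∀ (j : ℕ) (i : Fin k), Integrable (g j i) (μ (Ioc 0 δ)) := by
    intro j i
    have h := (integral_singleCollisionEvent_eq hε hε' (Fin.castAdd m' i) hρ hδV (Hj j i) (hHm j i)
      (integrable_eventSide hε hε' i (j * δ) δ V hB hW hWi (GenS i) rfl (Hj j i) rfl)).1
    simpa only [hg, hμ] using h
  have hGi : ∀ (j : ℕ) (i : Fin k), Integrable (G i) (μ (Ioc (j * δ) (j * δ + δ))) := by
    intro j i
    have hcomp : Integrable ((G i) ∘ (fun p : (Config (k + m') d (UnitAddTorus d) × EuclideanSpace ℝ d) × (sphere (0 : EuclideanSpace ℝ d) 1 × ℝ) => (p.1, (p.2.1, p.2.2 + j * δ)))) (μ (Ioc 0 δ)) :=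
      (hgi j i).congr (hae0.mono fun p hp => hGeq j i p hp)
    have h := ((measurePreserving_timeShift (n := k + m') (d := d) (j * δ) δ).integrable_comp_emb (measurableEmbedding_timeShift _)).1 hcomp
    simpa only [hμ] using h
  have hFluxj : ∀ (j : ℕ) (i : Fin k), ∫ p, g j i p ∂μ (Ioc 0 δ) = ∫ p, G i p ∂μ (Ioc (j * δ) (j * δ + δ)) := by
    intro j i
    have h := integral_comp_timeShift (n := k + m') (d := d) (j * δ) δ (G i)
    rw [show (∫ p, G i p ∂μ (Ioc (j * δ) (j * δ + δ))) = ∫ p, G i (p.1, (p.2.1, p.2.2 + j * δ)) ∂μ (Ioc 0 δ) from by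
      simp only [hμ]; exact h.symm]
    exact integral_congr_ae (hae0.mono fun p hp => hGeq j i p hp)
  have hsumG : ∀ i : Fin k, ∑ j ∈ Finset.range N, ∫ p, G i p ∂μ (Ioc (j * δ) (j * δ + δ)) = ∫ p, G i p ∂μ (Ioc 0 (N * δ)) := by
    intro i
    have h := (sum_integral_timeWindows (n := k + m') (d := d) hδ.le N (G i) (fun j _ => by
      have := hGi j i
      rw [show (j : ℝ) * δ + δ = (j + 1) * δ by ring] at this
      simpa only [hμ] using this)).2
    simp only [hμ]
    rw [← h]
    refine Finset.sum_congr rfl fun j _ => ?_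
    rw [show ((j : ℝ) + 1) * δ = j * δ + δ by ring]
  -- Step 4: assemble
  have hLHS : (F (N * δ) - F 0) - (m' + 1 : ℝ) * ∑ i : Fin k, ∫ p, G i p ∂μ (Ioc 0 (N * δ)) =
      ∑ j ∈ Finset.range N, ((F (j * δ + δ) - F (j * δ)) - (m' + 1 : ℝ) * ∑ i : Fin k, ∫ p, g j i p ∂μ (Ioc 0 δ)) := by
    rw [Finset.sum_sub_distrib, htel N, ← Finset.mul_sum]
    congr 1
    congr 1
    rw [Finset.sum_comm]
    refine Finset.sum_congr rfl fun i _ => ?_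
    rw [← hsumG i]
    exact Finset.sum_congr rfl fun j _ => (hFluxj j i).symm
  have hDi : ∀ j : ℕ, IntegrableOn (fun z₀ : Config (k + (m' + 1)) d (UnitAddTorus d) => (Dirty j).indicator (1 : Config (k + (m' + 1)) d (UnitAddTorus d) → ℝ) z₀ * |W z₀|) (Alexander.good (Torus.geometry d) ε) := by
    intro j
    have hDm : MeasurableSet (Dirty j) := by
      have h1 := Alexander.measurable_collisionCount (N := k + (m' + 1)) hG hGm (j * δ)
      have h2 := Alexander.measurable_collisionCount (N := k + (m' + 1)) hG hGm (j * δ + δ)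
      have : Dirty j = (fun z₀ : Config (k + (m' + 1)) d (UnitAddTorus d) =>
          (Alexander.collisionCount (Torus.geometry d) ε z₀ (j * δ), Alexander.collisionCount (Torus.geometry d) ε z₀ (j * δ + δ))) ⁻¹'
            {q : ℕ × ℕ | q.1 + 2 ≤ q.2} := rfl
      rw [this]
      exact (Set.to_countable _).measurableSet.preimage (h1.prodMk h2)
    refine Integrable.mono' hWi.integrableOn.abs ((measurable_const.indicator hDm).mul (continuous_abs.measurable.comp hW)).aestronglyMeasurable
      (Filter.Eventually.of_forall fun z₀ => ?_)
    rw [Real.norm_eq_abs, abs_mul, abs_abs]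
    refine mul_le_of_le_one_left (abs_nonneg _) ?_
    by_cases h : z₀ ∈ Dirty j
    · rw [indicator_of_mem h, Pi.one_apply, abs_one]
    · rw [indicator_of_notMem h, abs_zero]; exact zero_le_one
  have hDsum : ∑ j ∈ Finset.range N, 2 * (∫ z₀ in Alexander.good (Torus.geometry d) ε, (Dirty j).indicator (1 : Config (k + (m' + 1)) d (UnitAddTorus d) → ℝ) z₀ * |W z₀|) =
      2 * ∫ z₀ in Alexander.good (Torus.geometry d) ε, (∑ j ∈ Finset.range N, (Dirty j).indicator (1 : Config (k + (m' + 1)) d (UnitAddTorus d) → ℝ) z₀) * |W z₀| := by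
    rw [← Finset.mul_sum, ← integral_finsetSum _ (fun j _ => hDi j)]
    congr 1
    refine integral_congr_ae (Filter.Eventually.of_forall fun z₀ => ?_)
    simp only [Finset.sum_mul]
  rw [← hF0]
  show |(F (N * δ) - F 0) - (m' + 1 : ℝ) * ∑ i : Fin k, ∫ p, G i p ∂μ (Ioc 0 (N * δ))| ≤
    2 * (∫ z₀ in Alexander.good (Torus.geometry d) ε, (∑ j ∈ Finset.range N, (Dirty j).indicator (1 : Config (k + (m' + 1)) d (UnitAddTorus d) → ℝ) z₀) * |W z₀|) +
      (m' + 1 : ℝ) * ∑ i : Fin k, ∑ j ∈ Finset.range N, Err j i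
  rw [hLHS, ← hDsum, Finset.sum_comm, Finset.mul_sum, ← Finset.sum_add_distrib]
  refine (Finset.abs_sum_le_sum_abs _ _).trans (Finset.sum_le_sum fun j _ => ?_)
  rw [← hInc j]
  exact hwin j

end Sum

end Kinetic

end

end Literature.MathematicalPhysics.KineticTheory
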